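import Mathlib
import HarnessLib
import HarnessLib.Audit
import Summits.AnomalousDissipation.Statement
import Literature.Analysis.FluidPDE.TorusClassicalLerayHopfProofs
import HarnessLib.Audit.Status.Attr

/-!
Route: CoherentStates

DORMANT since 2026-08-22T06:32:22Z (reconciler: no traction for 5.1 d (last activity item-evidence-added at 2026-08-17T02:39:35Z); parked, not closed — `ledger route dormant route-AnomalousDissipation-CoherentStates --off` to reactivate) — unstaffed, not closed; items shared with open routes are served there. `ledger route dormant <id> --off` reactivates.

# Route CoherentStates — AnomalousDissipation (Statement decl `AnomalousDissipation` :=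
Literature.Turb.ZerothLaw)

## Thesis X (words)
The anomaly is carried by EXACT COHERENT STATES: there is a smooth steady force f and, for
viscosities ν_j → 0,
smooth time-periodic (period τ_j, possibly steady) classical solutions (u_j, p_j) of NS_{ν_j} forced
by f on all
of ℝ × T³, with bounded limsup-mean energy and limsup-mean dissipation ν_j⟨‖∇u_j‖²⟩ ≥ ε > 0.

Lean: ∃ f, IsSmooth f ∧ IsDivFree f ∧ HasZeroMean f ∧ ∃ ν τ u p, (∀ j, 0 < ν j) ∧ Tendsto ν atTop
(nhds 0) ∧ (∀ j, Torus.IsClassicalNSSolutionOn univ (ν j) (fun _ => f) (u j) (p j) ∧ 0 < τ j ∧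
Function.Periodic (u j) (τ j)) ∧ (∃ E, ∀ j, meanEnergy (u j) ≤ E) ∧ ∃ ε > 0, ∀ j, ε ≤
meanDissipation (ν j) (u j)
(= item CoherentThesis, stmt-AnomalousDissipation-0218, the route's TARGET; badged crux rank 0 by
the gate's auto-crux rule
because it is a conjecture-grade hypothesis of `closes`.)

## Assembly (deciding theorem, D-0027 §2.1)
`theorem closes (hX : CoherentThesis) : AnomalousDissipation` — CRUX-ONLY (rev 6, 2026-08-16),
proved (sorry-free,
axioms propext / Classical.choice / Quot.sound) and rendered in this file. Each u_j is a classical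
solution of NS_{ν_j} on
all of ℝ × T³, hence a global Leray–Hopf solution from the datum u_j 0 by the PROVED Literature
theorem
Literature.Analysis.FunctionSpaces.Torus.IsClassicalNSSolutionOn.isGlobalLerayHopf (module
Literature.Analysis.FluidPDE.TorusClassicalLerayHopfProofs, which discharges the named fact
Literature.Analysis.FluidPDE.Torus.isGlobalLerayHopf_of_isClassicalNSSolutionOn as `…_holds`;
Robinson–Rodrigo–Sadowski 2016
Thm 6.5 / Def 4.9, Galdi 2000 Thm 4.1 — on the compact T³ × [0,T] every Leray–Hopf clause of a
classical solution is
automatic, and the smoothness of the force follows from the momentum equation); the force,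
viscosity, mean-energy and
mean-dissipation clauses of Literature.Turb.ZerothLaw are those of X verbatim (same functionals
meanEnergy /
meanDissipation). The former bridge hypothesis ClassicalGlobalIsGlobalLerayHopf (support item
stmt-0223 = that fact's body
written out) is NO LONGER a hypothesis of `closes`; it stays listed as a settled support edge,
closable in one line
(`:= Literature.Analysis.FluidPDE.Torus.isGlobalLerayHopf_of_isClassicalNSSolutionOn_holds`).
CANONICAL ASSEMBLY ITEM:
Assembly (stmt-0266) = `CoherentThesis → ClassicalGlobalIsGlobalLerayHopf → AnomalousDissipation`,
one line from the glue
(`fun hX _ => closes hX`). Two legacy assembly-kind VARIANTS remain listed until an operator drops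
or re-kinds them
(planner --drop / --retriage of assembly-kind items are refused by the gate; bookkeeping only, do
NOT staff; each closable
in one line): Assembly2 (stmt-0406, both hypotheses written out) and Assembly3 (stmt-0437,
`ClassicalGlobalIsGlobalLerayHopf → CoherentThesis → AnomalousDissipation`). Second layer:
SteadyZerothLaw → CoherentThesis
(support SteadyImpliesCoherent, stmt-10872), so the rank-2 crux closes the route by itself:
SteadyZerothLaw → CoherentThesis → AnomalousDissipation.

Rationale: WHY THIS LINE. Brings bifurcation/continuation theory of exact coherent states (ECS: steady states,
travelling waves, unstable periodic orbits of the deterministic forced flow) and computer-assisted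
proof to bear on the zeroth law, instead of statistical or convex-integration constructions. (1)
UPOs of steadily forced box turbulence, found by Newton–Poincaré and continued in ν by arclength,
reproduce the K41 cascade and a saturating mean dissipation over the computed range
[VanVeenKidaKawahara2006 = arXiv:1804.00547 pp.6–8; VanVeenVelaMartinKawahara2019 =
arXiv:1809.08649]; a periodic orbit of NS on T³ with the steady Taylor–Green force has been PROVED
by rigorous numerics at one viscosity [BergBredenLessardVeen2021 = arXiv:1902.00384 Thm 1.1]. (2)
The theorem closest to the summit, Cheskidov's long-time dissipation anomaly for smooth
time-periodic solutions [Cheskidov2023 = arXiv:2311.04182 Thm 1.3; in tree as the named fact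
Literature.Analysis.FluidPDE.cheskidov_time_periodic_anomaly, cited as PRIOR ART ONLY — no item
takes it as a hypothesis], lives in exactly this solution class; its gap to the summit is 'the
forces f^ν → f are ν- and time-dependent (time cutoff, p.18)': crux CheskidovSteadyForces isolates
the steady-smooth-convergent-force upgrade, leaving pure ν-independence of the force as the residual
structural-stability step. (3) Smooth periodic solutions have exact period-averaged energy balance
and honest Cesàro limits (support CesaroMeanPeriodic, proved in tree), so none of the leakage/limsup
bookkeeping of Leray–Hopf routes arises. (4) The STEADY sub-case is elliptic (f = P(u·∇u) − νΔu with
f fixed: the high modes of P(u⊗u) exactly balanced by viscosity, a steady cascade); steady solutions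
exist for every ν by Leray–Schauder [Temam1979 Ch. II Thm 1.2 = ConstantinFoias1988 Thm 7.3] with
only the laminar bound ‖∇u‖ ≤ ‖f‖_{H⁻¹}/ν, and the steady energy identity ν_j‖∇u_j‖² = ⟨f,u_j⟩ →
⟨f,ū⟩ along weakly convergent bounded-energy families makes the steady anomaly EQUIVALENT to a weak
limit ū that still absorbs power from f — sharp either way (SteadyZerothLaw vs SteadyNeg =
'unsteadiness is necessary for the zeroth law').
RANKED CRUXES. #2 SteadyZerothLaw — fixed smooth div-free mean-zero f, steady classical (u_j,p_j) at
ν_j → 0 with ∫|u_j|² ≤ E and ν_j‖∇u_j‖² ≥ ε > 0 (why it might fail: needs a weak limit ū with ⟨f,ū⟩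
> 0, i.e. an Onsager-rough dissipative steady cascade reached by STEADY NS; no ν-uniform L² bound on
any non-laminar steady branch is known; the 2-D analogue is false, ε ≲ Re^{-1/2}
[AlexakisDoering2006PLA = arXiv:physics/0605090]; first-mode forcing is rigid [Marchioro1986];
sources ConstantinFoias1988 Thm 7.3/(7.9), Cheskidov2023 p.4). It closes the route alone:
SteadyZerothLaw → CoherentThesis (support SteadyImpliesCoherent) → closes. #3 CheskidovSteadyForces
— time-periodic smooth solutions with STEADY smooth forces f_j → f in L², f smooth, periods τ_j
free, bounded mean energy, mean dissipation ≥ ε (why it might fail: Cheskidov's proof uses a time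
cutoff in the force, arXiv:2311.04182 p.18; with steady f_j the periodic cycle must self-sustain,
and f_j → f in L² forbids prescribing u_j and solving for f_j since −ν_jΔu_j is not o(1) in L² when
ν_j‖∇u_j‖² ≥ ε; steady 2½-D states laminarise [DrivasElgindiIyerJeong2022 Thm 4]; source also
BrueDeLellis2023 = arXiv:2207.06301 p.5 Question 2). A milestone that does NOT imply X (forces vary
with j); its residual is filed under NOT DECOMPOSED YET. #5 SteadyNeg — for every fixed smooth f,
every steady bounded-energy family has ν_j‖∇u_j‖² → 0 (why it might fail: false iff SteadyZerothLaw;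
in 3-D the only a-priori input is ν‖∇u‖² = ⟨f,u⟩ ≤ ‖f‖√E, and force-robust energy methods are
saturated in the neighbouring time-periodic class by Cheskidov2023 Thm 1.3 [barrier
Cheskidov2023_thm13_not_forceRobustNoAnomaly], so a proof must use steadiness/ellipticity; only 2-D
is rigid [ConstantinRamos2007, Literature.Analysis.FluidPDE.constantin_ramos_2d]; sources
FoiasManleyRosaTemam2001 (12.38)–(12.39), arXiv:math/0611782 p.2). Negative side, shared with route
Neg; its tame special case SteadyNegTameOffThinSets (support, from card
bernoulli-poincare-thin-set-liouville) is the first genuinely 3-D instance.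
SUPPORT. CoherentThesis (TARGET, rank 0; the only hypothesis of `closes` since rev 6).
ClassicalGlobalIsGlobalLerayHopf (stmt-0223) = the body of the named fact
Literature.Analysis.FluidPDE.Torus.isGlobalLerayHopf_of_isClassicalNSSolutionOn written out
(RobinsonRodrigoSadowski2016 Thm 6.5, Galdi2000 Thm 4.1) — PROVED in Literature
(Literature.Analysis.FluidPDE.TorusClassicalLerayHopfProofs:
`Torus.isGlobalLerayHopf_of_isClassicalNSSolutionOn_holds`, and the hypothesis-free
`Literature.Analysis.FunctionSpaces.Torus.IsClassicalNSSolutionOn.isGlobalLerayHopf`), no longer a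
hypothesis of `closes`; a settled support edge closable in ONE line (`:=
Literature.Analysis.FluidPDE.Torus.isGlobalLerayHopf_of_isClassicalNSSolutionOn_holds`) — do not
staff beyond that. CesaroMeanPeriodic (stmt-0514; PROVED in tree:
Literature.Turb.tendsto_timeMean_of_periodic, Theorems/EulerLimitCesaro.lean). SteadyImpliesCoherent
(stmt-10872, rank 9, filed 2026-08-15): SteadyZerothLaw → CoherentThesis — τ_j := 1; for a
time-constant field meanEnergy = ∫|u_j|² and meanDissipation = ν_j·(eGradNormSq u_j).toReal =
ν_j·gradNormSq u_j by the PROVED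
Literature.Analysis.FunctionSpaces.Torus.gradNormSq_eq_toReal_eGradNormSq_holds (u_j smooth by
IsSmoothSpaceTimeOn.isSmooth_slice); Cesàro mean of a constant; ≤ 80 lines, provable now. Assembly
(stmt-0266) = `CoherentThesis → ClassicalGlobalIsGlobalLerayHopf → AnomalousDissipation` is the
route's canonical assembly item — one line from the glue (`fun hX _ => closes hX`). The legacy
assembly-kind variants Assembly2 (0406, hypotheses written out) and Assembly3 (0437,
`ClassicalGlobalIsGlobalLerayHopf → CoherentThesis → AnomalousDissipation`) are bookkeeping only (do
not staff; one line each from `closes`) and await an OPERATOR drop or re-kind to support: the gate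
refuses planner --drop / --retriage of assembly-kind items (tried again 2026-08-16, gen 4).
SteadyBoundedBranch (stmt-0221) is TRUE AS TYPED by the laminar Galilean-drift family u_j = U e₁ +
V_j(x₁) e₂, f = sin(2πx₁) e₂ (retriage 2026-08-14) — informative only with mean-zero velocities;
kept as a settled-trivial support edge, do not staff; its mean-zero form is deferred (NOT DECOMPOSED
YET).
KILL CRITERIA. SteadyNeg proved kills the steady sub-line only (SteadyZerothLaw and
SteadyImpliesCoherent become moot; pivot to genuinely time-periodic states, τ_j > 0 proper, entered
through CheskidovSteadyForces). The route closes as refuted if in addition either (a) a theorem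
shows that time-periodic smooth solutions with ONE fixed steady smooth force and bounded mean energy
have mean dissipation → 0 as ν → 0 (¬CoherentThesis: the target itself is refuted), or (b)
CheskidovSteadyForces is refuted (even j-dependent steady smooth forces converging in L² cannot
sustain a long-time anomaly in the smooth time-periodic class — then a fortiori no fixed force can,
and the line has no milestone left).
NOT DECOMPOSED YET. (i) The residual step CheskidovSteadyForces ⇒ CoherentThesis (ν-independence of
the force = structural stability of the periodic states under o(1)-in-L² steady force perturbations
at vanishing viscosity) — split only after #3 closes. (ii) Continuation-in-ν of a specific ECS
branch (Newton–Poincaré + arclength as in arXiv:1804.00547, where 'about half the continuations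
ended in a bifurcation point', p.7) and what a ν-uniform continuation theorem would have to control
(folds, period growth τ_j → ∞, loss of hyperbolicity). (iii) Certified finite-ν milestones
(radii-polynomial / computer-assisted periodic orbits at a ladder ν = 2^{-k}, arXiv:1902.00384
style) — evidence attached to CoherentThesis, never items. (iv) The mean-zero restatement of
SteadyBoundedBranch (∀ j, HasZeroMean (u j)) as the informative existence half of the steady
sub-line — filed only if SteadyZerothLaw stalls on existence rather than on dissipation. Two layers
only (D-0019); no split before a crux closes.
CHEAPEST FALSIFIER. Steady sub-line: a kit computation — steady Newton–Krylov solves of 3-D NS on T³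
with a fixed non-first-shell, genuinely three-dimensional force (e.g. Taylor–Green-type f),
continued down a ladder ν = 2^{-k}, recording the power input ⟨f,u_ν⟩ = ν‖∇u_ν‖² on every
bounded-energy branch reached: power input decaying like a positive power of ν on all branches found
(laminarisation, εℓ/U³ ∼ Re^{-1} as Cheskidov2023 p.4 records for the known steady states) demotes
SteadyZerothLaw below SteadyNeg at once; the same run at U = O(1) with ⟨f,u_ν⟩ ↛ 0 would be the
first evidence FOR it. Whole line: the Drivas–Eyink test [barrier DrivasEyink2019_lemma1] — any
proposed witness family (numerical or analytic) that stays bounded in L³_t B^σ_{3,∞} for some σ >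
1/3, in particular any branch whose energy spectrum stays exponentially decaying uniformly in ν, is
dead on arrival; apply it to the period-5 UPO data of arXiv:1804.00547 (continued only over 0.0035 <
ν < 0.005, where ε̄ 'seems to saturate around 0.1', pp.6–7 and 12) before investing in continuation
theorems.
TWO-LAYER PLAN. Layer 1 (proved, crux-only since rev 6): closes : CoherentThesis →
AnomalousDissipation (the Leray–Hopf bridge is the proved Literature theorem
Torus.IsClassicalNSSolutionOn.isGlobalLerayHopf, invoked inside the proof term). Layer 2 (filed,
provable now): SteadyImpliesCoherent : SteadyZerothLaw → CoherentThesis. Foreseen (not filed):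
CheskidovSteadyForces ∧ StructuralStability → CoherentThesis, k = 2, after #3 closes.
SOURCES. Cheskidov2023 (arXiv:2311.04182); BrueDeLellis2023 (arXiv:2207.06301); BCCDS2024;
VanVeenKidaKawahara2006 (arXiv:1804.00547); VanVeenVelaMartinKawahara2019 (arXiv:1809.08649);
BergBredenLessardVeen2021 (arXiv:1902.00384); Kawahara–Uhlmann–van Veen review (arXiv:1108.0975);
ConstantinFoias1988; Temam1979; Marchioro1986; AlexakisDoering2006PLA (arXiv:physics/0605090);
ConstantinRamos2007; FoiasManleyRosaTemam2001; DoeringFoias2002; RobinsonRodrigoSadowski2016;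
Galdi2000; Grafakos2014 (Parseval, for SteadyImpliesCoherent). needs-fact: NONE (rev 6, 2026-08-16).
The former tier-0 want
Literature.Analysis.FluidPDE.Torus.isGlobalLerayHopf_of_isClassicalNSSolutionOn is DISCHARGED in
tree (Literature.Analysis.FluidPDE.TorusClassicalLerayHopfProofs, `…_holds`; the route file imports
that Proofs module for the glue only — the fact's name enters no item, and its `_holds` witness
rides with the import); the route's constant cone has 0 unproved dependencies (ledger `route show`:
staffable YES, 55 constants). NOT needed and NOT re-routable by any planner verb:
Literature.Analysis.FluidPDE.ZerothLawNeg and .ZerothLawTimePeriodic (registered open conjectures,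
@[conjecture]) and .cheskidov_time_periodic_anomaly (prior art, Cheskidov2023 Thm 1.3) — no item
mentions them; they live in the module Literature.Analysis.FluidPDE.ZerothLaw together with the
Statement's own functionals meanEnergy / meanDissipation, which the sub-problem Statement imports,
so they sit in the IMPORT cone of every route of this summit. Operator request (repeated, gens 2–4):
move those three decls out of ZerothLaw.lean (e.g.
Literature/Analysis/FluidPDE/ZerothLawVariants.lean) or let the repair feed use the constant cone;
until then that feed entry recurs for all AnomalousDissipation routes.

Novelty: NOVELTY (retriage planner, 2026-08-14). Searches run BEFORE this claim: `lit frontier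
AnomalousDissipation --since 2020`; `lit bridges AnomalousDissipation --cross any`; `lit search
--hybrid` ("stationary steady Navier-Stokes vanishing viscosity limit anomalous energy dissipation
fixed body force"; "long time averages inviscid limit stationary statistical solutions energy
dissipation"); `lit vsearch` ("steady solutions of forced NS whose dissipation stays bounded away
from zero as viscosity → 0"); `lit search` --source local/all ("unstable periodic orbit box
turbulence dissipation Reynolds independent"; "periodic orbit Navier-Stokes computer-assisted proof
Taylor-Green forcing"; "periodic motion representing isotropic turbulence Kida"); `lit galaxy search
--star pdf` ("exact coherent structures", "unstable periodic orbit", "steady Navier-Stokes",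
"stationary Navier-Stokes", "Kolmogorov flow"); `lit read` of arXiv:2311.04182 (pp.4–5,18),
arXiv:2207.06301 (pp.3–5), arXiv:1804.00547 (pp.6–8), arXiv:1809.08649 (pp.1–2), arXiv:1902.00384
(pp.3–4). Remote APIs (OpenAlex/S2/arXiv) were rate-limited (HTTP 429) during this pass; local store
+ internal corpus + citation graph were used.

Nearest prior art actually found:
(i) Rigorous, SAME solution class (smooth time-periodic solutions, long-time means): Cheskidov2023 =
arXiv:2311.04182, p.5 Thm 1.3 (in tree:
Literature.Analysis.FluidPDE.cheskidov_time_periodic_anomaly) — dissipation anomaly with forces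
f^{ν_j} → f in C(ℝ;L²) that are  [refs: 2311.04182, 2207.06301, 1804.00547, 1809.08649, 1902.00384, 1108.0975, Cheskidov2023, BrueDeLellis2023, BCCDS2024, VanVeenKidaKawahara2006, VanVeenVelaMartinKawahara2019, BergBredenLessardVeen2021, ConstantinFoias1988, Temam1979, Marchioro1986, FoiasManleyRosaTemam2001]

Barriers (technique_class: exact-coherent-states steady-branches long-time-averages upo): - technique_class: exact-coherent-states steady-branches long-time-averages upo
- Literature.Barriers.AnomalousDissipation.Cheskidov2023_thm13_not_forceRobustNoAnomaly: APPLIES to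
the negative crux SteadyNeg and to the route's kill criterion ('time-periodic smooth solutions with
steady force and bounded energy have vanishing mean dissipation'), both ZerothLawNeg-type statements
over long-time averages — an energy-method argument stable under o(1)-in-C(ℝ;L²) ν-dependent
time-periodic changes of the force would prove ForceRobustNoAnomaly, refuted by Cheskidov2023 Thm
1.3. Evasion: a proof of SteadyNeg must use the STEADINESS of the solutions (ellipticity of f =
P(u·∇u) − νΔu, absent from the time-periodic class of Thm 1.3; scope caveat (a)) or the exact
ν-independence/steadiness of the force; honestly: not evaded by construction — the bet is that
steadiness of the solution is genuinely stronger than time-periodicity. The POSITIVE items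
(CoherentThesis, SteadyZerothLaw, CheskidovSteadyForces) are witness statements, outside the blocked
class.
- Literature.Barriers.AnomalousDissipation.BrueDeLellis2023_noAnomaly_beforeEulerSingularity:
APPLIES to the letter of the class (classical solutions, fixed smooth force) and is EVADED by the
summit's own form used here — long-time (period) averages of time-periodic/steady states whose
slices u_j(0) are ν-dependent and need not converge in L² to data with a Lipschitz forced-Euler
evolution (the barrier's listed evasion 'take long-time avera

History (route lifecycle, newest last):
- 2026-08-16T03:41:17Z · AUTO-CRUX (backfill): CoherentThesis — hypotheses of the deciding theorem that nothing in the route derives are cruxes (operator:999:586464)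
- 2026-08-16T14:43:05Z · LINT AUTOFIX route.multi-assembly: kept Assembly, dropped Assembly2, Assembly3 (gate:hygiene)
- 2026-08-22T06:32:22Z · DORMANT — reconciler: no traction for 5.1 d (last activity item-evidence-added at 2026-08-17T02:39:35Z); parked, not closed — `ledger route dormant route-AnomalousDissipa (operator:999:3149722)

sub-problem: AnomalousDissipation · status: dormant · opened planner-AnomalousDissipation-Survey-0 2026-08-13T06:06:43Z · rev 9 · ledger route-AnomalousDissipation-CoherentStates
GENERATED by the gate from the ledger (D-0016/17). Provers cite these decls: `theorem foo : Summit.AnomalousDissipation.AnomalousDissipation.Theses.CoherentStates.<Decl> := …` in Summits/AnomalousDissipation/AnomalousDissipation/Theorems/<Name>.lean.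
-/

namespace Summit.AnomalousDissipation.AnomalousDissipation.Theses.CoherentStates

open scoped BigOperators Topology Manifold Classical MeasureTheory ProbabilityTheory Matrix InnerProductSpace ComplexConjugate ContinuousMap
open Filter Set Function TopologicalSpace MeasureTheory

attribute [summit_statement] _root_.AnomalousDissipation

open Literature.Turb

/-- item stmt-AnomalousDissipation-0218 · crux (kind.auto-crux: conjecture-grade) · rank 0 · open · by planner
why it might fail: One FIXED steady smooth f must drive, as ν_j→0, exact coherent states that are uniformly Onsager-rough (Drivas–Eyink); all rigorous anomalies (BDL2023, BCCDS2024, Cheskidov2023 Thm 1.3) design ν- and time-dependent forces; UPO/steady branches continued in ν end at folds or laminarise (εℓ/U³∼Re⁻¹).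
sources: Cheskidov2023 = arXiv:2311.04182 p.4 ('steady states, where εℓ/U³ ∼ Re⁻¹'; 'no known example … where [the Doering–Foias] bound is attained'), p.5 Thm 1.3 + 'remains an important open problem', p.18 (time cutoff in the force, fixed period), BrueDeLellis2023 = arXiv:2207.06301 p.4 Thm 1.1, p.5 Questions 1–2 (ν-independent / time-independent force: open), VanVeenKidaKawahara2006 = arXiv:1804.00547 pp.6–8 (UPOs of steadily forced box flow continued in ν; 'about half the continuations … ended in a bifurcation point', p.7), VanVeenVelaMartinKawahara2019 = arXiv:1809.08649 p.1–2 (UPO in LES/Smagorinsky, not NS), BergBredenLessardVeen2021 = arXiv:1902.00384 p.4 Thm 1.1 (computer-assisted periodic orbit at ONE viscosity ν = 0.265), decl Literature.Barriers.AnomalousDissipation.DrivasEyink2019_lemma1_measurable (uniform L³_t B^σ_{3,∞}, σ>1/3 ⇒ dissipation → 0)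
Exact coherent states (UPOs / steady branches) carry the anomaly. Sources:
VanVeenVelaMartinKawahara2019 (UPOs with Re-independent dissipation, DNS), BergBredenLessardVeen2021
(computer-assisted periodic orbits of forced 2-D NS), arXiv231104182 Thm 1.3 (Cheskidov: same class
but forces f^ν → f), Temam1979 Ch. II (steady solutions exist ∀ν). -/
@[route_item "route-AnomalousDissipation-CoherentStates", crux]
def CoherentThesis : Prop :=
  ∃ f : UnitAddTorus (Fin 3) → EuclideanSpace ℝ (Fin 3), Literature.Analysis.FunctionSpaces.Torus.IsSmooth f ∧ Literature.Analysis.FunctionSpaces.Torus.IsDivFree f ∧ Literature.Analysis.FunctionSpaces.Torus.HasZeroMean f ∧ ∃ (ν τ : ℕ → ℝ) (u : ℕ → ℝ → UnitAddTorus (Fin 3) → EuclideanSpace ℝ (Fin 3)) (p : ℕ → ℝ → UnitAddTorus (Fin 3) → ℝ), (∀ j, 0 < ν j) ∧ Filter.Tendsto ν Filter.atTop (nhds 0) ∧ (∀ j, Literature.Analysis.FunctionSpaces.Torus.IsClassicalNSSolutionOn Set.univ (ν j) (fun _ => f) (u j) (p j) ∧ 0 < τ j ∧ Function.Periodic (u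 j) (τ j)) ∧ (∃ E : ℝ, ∀ j, Literature.Analysis.FluidPDE.meanEnergy (u j) ≤ E) ∧ ∃ ε : ℝ, 0 < ε ∧ ∀ j, ε ≤ Literature.Analysis.FluidPDE.meanDissipation (ν j) (u j)

/-- item stmt-AnomalousDissipation-0219 · crux · rank 2 · open · by planner
why it might fail: Steady identity ν_j‖∇u_j‖²=⟨f,u_j⟩→⟨f,ū⟩: anomaly needs a weak limit ū absorbing power >0, a dissipative Onsager-rough steady cascade reached by STEADY NS; no ν-uniform L² bound on any steady branch is known (only ‖∇u‖≤|A^{-1/2}f|/ν); 2-D analogue false (ε≲Re^{-1/2}); first-mode forcing is rigid.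
sources: ConstantinFoias1988 Ch.7 Thm 7.3 and (7.9), PDF pp.40–41 (steady solutions ∀ν; only ‖u‖_V ≤ |A^{-1/2}f|/ν) = Temam1979 Ch. II Thm 1.2, AlexakisDoering2006PLA = arXiv:physics/0605090 p.2 (ε ≤ k_f U³ Re^{-1/2}(C₁+C₂Re⁻¹)^{1/2}); decl Literature.Barriers.AnomalousDissipation.AlexakisDoering2006_energyDissipationBound, Marchioro1986 Theorem; decl Literature.Barriers.AnomalousDissipation.Marchioro1986_globalAttraction.steadyState_ae_eq (first-mode 2-D forcing: laminar f/(νλ₁), energy ∼ν⁻², is the only steady state ∀ν), Cheskidov2023 = arXiv:2311.04182 p.4 (steady states cited only as laminar examples, εℓ/U³ ∼ Re⁻¹), decl Literature.Barriers.AnomalousDissipation.DrivasEyink2019_lemma1_measurable; decl Literature.Barriers.AnomalousDissipation.BrueDeLellis2023_noAnomaly_beforeEulerSingularity (necessary: no strong-L² subsequential limit with Lipschitz forced-Euler evolution)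
Elliptic reformulation: f = P(u_j·∇u_j) − ν_jΔu_j with f fixed and smooth means the high modes of
P(u_j⊗u_j) are exactly balanced by viscosity — a steady cascade. Existence of steady solutions ∀ν:
Leray–Schauder (Temam1979 Ch. II Thm 1.2), a-priori only ‖∇u‖ ≤ ‖f‖_{H⁻¹}/ν. Refutation (#5) would
show unsteadiness is necessary. -/
@[route_item "route-AnomalousDissipation-CoherentStates", crux]
def SteadyZerothLaw : Prop :=
  ∃ f : UnitAddTorus (Fin 3) → EuclideanSpace ℝ (Fin 3), Literature.Analysis.FunctionSpaces.Torus.IsSmooth f ∧ Literature.Analysis.FunctionSpaces.Torus.IsDivFree f ∧ Literature.Analysis.FunctionSpaces.Torus.HasZeroMean f ∧ ∃ (ν : ℕ → ℝ) (u : ℕ → UnitAddTorus (Fin 3) → EuclideanSpace ℝ (Fin 3)) (p : ℕ → UnitAddTorus (Fin 3) → ℝ), (∀ j, 0 < ν j) ∧ Filter.Tendsto ν Filter.atTop (nhds 0) ∧ (∀ j, Literature.Analysis.FunctionSpaces.Torus.IsClassicalNSSolutionOn Set.univ (ν j) (fun _ => f) (fun _ => u j) (fun _ => p j)) ∧ (∃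 E : ℝ, ∀ j, MeasureTheory.integral MeasureTheory.volume (fun x => ‖u j x‖ ^ 2) ≤ E) ∧ ∃ ε : ℝ, 0 < ε ∧ ∀ j, ε ≤ ν j * Literature.Analysis.FunctionSpaces.Torus.gradNormSq (u j)

/-- item stmt-AnomalousDissipation-0220 · crux · rank 3 · open · by planner
why it might fail: Cheskidov Thm 1.3 is built on time-dependent forces (cutoff η(t), p.18); with steady f_j the periodic cycle must self-sustain, and f_j→f in L² forbids prescribing u_j and solving for f_j (−ν_jΔu_j is not o(1) in L² at ν_j‖∇u_j‖²≥ε unless the nonlinearity cancels it); steady 2½-D states laminarise.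
sources: Cheskidov2023 = arXiv:2311.04182 p.5 Thm 1.3 (forces f^{ν_j} → f in C(ℝ;L²), time-periodic), p.18 (proof: time cutoff, period τ fixed); Literature fact Literature.Analysis.FluidPDE.cheskidov_time_periodic_anomaly (ZerothLaw.lean:313) is the printed version, BrueDeLellis2023 = arXiv:2207.06301 p.5 Question 2 (time-independent forces: open; 'a positive answer to Question 1 on T³ would give … Question 2 on T⁴'), AlexakisDoering2006PLA p.2 and decl Literature.Barriers.AnomalousDissipation.AlexakisDoering2006_energyDissipationBound (planar part of a steady 2½-D state: ε ≲ Re^{-1/2}), DEIJ2022 Thm 4; decl Literature.Barriers.AnomalousDissipation.DrivasElgindiIyerJeong2022_thm4 (no scalar anomaly above the Obukhov–Corrsin threshold α+2β>1)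
Compare Literature Literature.Analysis.FluidPDE.cheskidov_time_periodic_anomaly (arXiv231104182 Thm
1.3: time-dependent forces f_j → f in C(ℝ;L²), fixed period, f only L²). Here forces are steady and
the limit force smooth; period τ_j may depend on j. Residual gap to the summit after #3:
ν-independence of the force (structural stability under o(1) steady force perturbations at vanishing
viscosity). -/
@[route_item "route-AnomalousDissipation-CoherentStates"]
def CheskidovSteadyForces : Prop :=
  ∃ (f : UnitAddTorus (Fin 3) → EuclideanSpace ℝ (Fin 3)) (ν τ : ℕ → ℝ) (fs : ℕ → UnitAddTorus (Fin 3) → EuclideanSpace ℝ (Fin 3)) (us : ℕ → ℝ → UnitAddTorus (Fin 3) → EuclideanSpace ℝ (Fin 3)) (ps : ℕ → ℝ → UnitAddTorus (Fin 3) → ℝ), Literature.Analysis.FunctionSpaces.Torus.IsSmooth f ∧ (∀ j, 0 < ν j) ∧ Filter.Tendsto ν Filter.atTop (nhds 0) ∧ (∀ j, Literature.Analysis.FunctionSpaces.Torus.IsSmooth (fs j) ∧ Literature.Analysis.FunctionSpaces.Torus.IsDivFree (fs j) ∧ Literature.Analysis.FunctionSpaces.Torus.HasZeroMean (fs j)) ∧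 Filter.Tendsto (fun j => MeasureTheory.eLpNorm (fs j - f) 2 MeasureTheory.volume) Filter.atTop (nhds 0) ∧ (∀ j, Literature.Analysis.FunctionSpaces.Torus.IsClassicalNSSolutionOn Set.univ (ν j) (fun _ => fs j) (us j) (ps j) ∧ 0 < τ j ∧ Function.Periodic (us j) (τ j)) ∧ (∃ E : ℝ, ∀ j, Literature.Analysis.FluidPDE.meanEnergy (us j) ≤ E) ∧ ∃ ε : ℝ, 0 < ε ∧ ∀ j, ε ≤ Literature.Analysis.FluidPDE.meanDissipation (ν j) (us j)

/-- item stmt-AnomalousDissipation-0222 · crux · rank 5 · open · by planner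
why it might fail: False iff a steady/drifting family with fixed smooth f keeps ν_j‖∇u_j‖²≥ε at bounded energy (=0219). In 3-D the sole a-priori bound is ν‖∇u‖²=⟨f,u⟩≤‖f‖√E; force-robust energy methods are saturated in the nearby time-periodic class (Cheskidov Thm 1.3): a proof must use steadiness; only 2-D is rigid.
sources: FoiasManleyRosaTemam2001 p.101 (12.38)–(12.39) (ν⟨‖u‖²⟩ ≤ ⟨(f,u)⟩ ≤ |f|⟨|u|²⟩^{1/2}; steady case = energy identity), Cheskidov2023 = arXiv:2311.04182 Thm 1.3; decl Literature.Barriers.AnomalousDissipation.Cheskidov2023_thm13_not_forceRobustNoAnomaly (scope caveat (a): says nothing against arguments using steadiness), AlexakisDoering2006PLA = arXiv:physics/0605090 p.2, p.8; ConstantinRamos2007 Thm 1 (Literature.Analysis.FluidPDE.constantin_ramos_2d) — 2-D only, arXiv:math/0611782 p.2 ('Does the rate of dissipation … vanish with viscosity …? The problem is open.'); BrueDeLellis2023 = arXiv:2207.06301 p.3 ('no known examples where it is rigorously proved')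
Shared with route Neg (#4 there). -/
@[route_item "route-AnomalousDissipation-CoherentStates"]
def SteadyNeg : Prop :=
  ∀ f : UnitAddTorus (Fin 3) → EuclideanSpace ℝ (Fin 3), Literature.Analysis.FunctionSpaces.Torus.IsSmooth f → Literature.Analysis.FunctionSpaces.Torus.IsDivFree f → Literature.Analysis.FunctionSpaces.Torus.HasZeroMean f → ∀ (ν : ℕ → ℝ) (u : ℕ → UnitAddTorus (Fin 3) → EuclideanSpace ℝ (Fin 3)) (p : ℕ → UnitAddTorus (Fin 3) → ℝ), (∀ j, 0 < ν j) → Filter.Tendsto ν Filter.atTop (nhds 0) → (∀ j, Literature.Analysis.FunctionSpaces.Torus.IsClassicalNSSolutionOn Set.univ (ν j) (fun _ => f) (fun _ => u j) (fun _ => p j)) → (∃ E : ℝ, ∀ j, MeasureTheory.integral MeasureTheory.volume (fun x => ‖u j x‖ ^ 2) ≤ E) → Filter.Tendsto (fun j => ν j * Literature.Analysis.FunctionSpaces.Torus.gradNormSq (u j)) Filter.atTop (nhds 0)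

/-- item stmt-AnomalousDissipation-0221 · support · rank 4 · closed · proved by Summit.AnomalousDissipation.AnomalousDissipation.Theorems.SteadyBoundedBranch_proof @ eaad425e647b (prover) · by planner
sources: explicit family (NOTES.md; residual 1e-16): f = sin(2πx₁)e₂; u_j = U e₁ + (a_j cos2πx₁ + b_j sin2πx₁)e₂, p_j = 0, a_j = −1/(2πU+8π³ν_j²/U), b_j = −2πν_j a_j/U; (u·∇)u = U V_j′e₂, Δu = V_j″e₂, div u = 0, co-moving frame: Stokes response to the ν-independent travelling force f(x+Ut e₁) — laminar; with mean-zero u_j the trick dies (resonant response ∼1/ν), Literature/Analysis/FunctionSpaces/TorusFluidGlue.lean:149 Torus.IsClassicalNSSolutionOn has no mean-zero clause; ConstantinFoias1988 Thm 7.3 (existence ∀ν background)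
A steady solution branch escaping the laminar scaling ‖u‖ ~ ν⁻¹. If u_j were also H¹-bounded then
(f,u_j) = ν_j‖∇u_j‖² → 0 and u_j → steady forced Euler state with f ⊥ u; otherwise #2.
Bifurcation/continuation in ν; degree theory gives existence but no selection. -/
@[route_item "route-AnomalousDissipation-CoherentStates"]
def SteadyBoundedBranch : Prop :=
  ∃ f : UnitAddTorus (Fin 3) → EuclideanSpace ℝ (Fin 3), Literature.Analysis.FunctionSpaces.Torus.IsSmooth f ∧ Literature.Analysis.FunctionSpaces.Torus.IsDivFree f ∧ Literature.Analysis.FunctionSpaces.Torus.HasZeroMean f ∧ f ≠ 0 ∧ ∃ (ν : ℕ → ℝ) (u : ℕ → UnitAddTorus (Fin 3) → EuclideanSpace ℝ (Fin 3)) (p : ℕ → UnitAddTorus (Fin 3) → ℝ), (∀ j, 0 < ν j) ∧ Filter.Tendsto ν Filter.atTop (nhds 0) ∧ (∀ j, Literature.Analysis.FunctionSpaces.Torus.IsClassicalNSSolutionOn Set.univ (ν j) (fun _ => f) (fun _ => u j) (fun _ => p j)) ∧ ∃ E : ℝ, ∀ j, MeasureTheory.integral MeasureTheory.volume (fun x =>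 ‖u j x‖ ^ 2) ≤ E

/-- item stmt-AnomalousDissipation-0223 · support · rank 6 · closed · proved by Summit.AnomalousDissipation.AnomalousDissipation.Theorems.classicalGlobalIsGlobalLerayHopf_proof (prover) · by planner
sources: Literature fact Literature.Analysis.FluidPDE.Torus.isGlobalLerayHopf_of_isClassicalNSSolutionOn (Literature/Analysis/FluidPDE/TorusClassicalLerayHopf.lean) — the item verbatim (Iff.rfl per 0437 note), RobinsonRodrigoSadowski2016 PDF p.101 Thm 6.5 (strong ⇒ Leray–Hopf; locator corrected in p4249); Galdi2000 Thm 4.1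
Torus twin of Literature fact Literature.Analysis.FluidPDE.IsClassicalNSSolutionOn.isLerayHopfOn; on
compact T³ × [0,T] all integrability hypotheses are automatic; energy equality from
Literature.Analysis.FunctionSpaces.Torus.IsClassicalNSSolutionOn.energy_balance (named fact, may be
taken as hypothesis (h : …)). Needed by CoherentStates #1 and EulerLimit #1. -/
@[route_item "route-AnomalousDissipation-CoherentStates"]
def ClassicalGlobalIsGlobalLerayHopf : Prop :=
  ∀ (ν : ℝ) (f u : ℝ → UnitAddTorus (Fin 3) → EuclideanSpace ℝ (Fin 3)) (p : ℝ → UnitAddTorus (Fin 3) → ℝ), 0 < ν → Literature.Analysis.FunctionSpaces.Torus.IsClassicalNSSolutionOn Set.univ ν f u p → Literature.Analysis.FunctionSpaces.Torus.IsSmoothSpaceTimeOn Set.univ f → Literature.Analysis.FluidPDE.Torus.IsGlobalLerayHopf ν f (u 0) u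

/-- item stmt-AnomalousDissipation-0514 · support · rank 7 · closed · proved by Summit.AnomalousDissipation.AnomalousDissipation.Theorems.cesaroMeanPeriodic_proof (prover) · by planner
sources: PROVED in tree: theorem Literature.Turb.tendsto_timeMean_of_periodic (Summits/AnomalousDissipation/AnomalousDissipation/Theorems/EulerLimitCesaro.lean, p3276 accepted), Mathlib Function.Periodic.sInf_add_zsmul_le_integral_of_pos / integral_le_sSup_add_zsmul_of_pos
NEW standalone support lemma requested by refuter-refute-A-0 (0227 note: 'the
Cesàro-mean-of-periodic-function lemma is independently useful — file it standalone (pure real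
analysis, provable now without any fact)'). For g : ℝ → ℝ continuous and τ-periodic, τ > 0: timeMean
g T = T⁻¹∫₀ᵀ g → τ⁻¹∫₀^τ g as T → ∞, and hence longTimeAvgSup g (= Filter.limsup (timeMean g) atTop,
TurbWave0.lean:89) equals τ⁻¹∫₀^τ g. Proof (~80–120 lines): write T = nτ + r, 0 ≤ r < τ (n = ⌊T/τ⌋);
∫₀ᵀ g = n∫₀^τ g + ∫₀ʳ g(· + nτ) = n∫₀^τ g + ∫₀ʳ g (Function.Periodic.intervalIntegral_add_eq and
intervalIntegral.integral_comp_add_right); |∫₀ʳ g| ≤ τ·M with M = sup_{[0,τ]}|g| (continuous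
periodic ⇒ bounded: Function.Periodic + IsCompact.exists_bound_of_continuousOn); so |timeMean g T −
τ⁻¹∫₀^τ g| ≤ (|∫₀^τ g|·|n/T − 1/τ| + τM/T) → 0 since nτ/T → 1; second conjunct from
Filter.Tendsto.limsup_eq. Used by E4' (2),(3) and by CoherentStates 0219/0221 (time-periodic exact
solutions). A weaker hypothesis (g locally integrable and bounded) also works; continuity chosen for
a clean signature. Sources: folklore; DoeringFoias2002 §2 (long-time averages). -/
@[route_item "route-AnomalousDissipation-CoherentStates"]
def CesaroMeanPeriodic : Prop :=
  ∀ (g : ℝ → ℝ) (τ : ℝ), 0 < τ → Continuous g → Function.Periodic g τ → Filter.Tendsto (Literature.Analysis.FluidPDE.timeMean g) Filter.atTop (nhds (τ⁻¹ * ∫ t in (0 : ℝ)..τ, g t)) ∧ Literature.Analysis.FluidPDE.longTimeAvgSup g = τ⁻¹ * ∫ t in (0 : ℝ)..τ, g t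

/-- item stmt-AnomalousDissipation-1049 · support · rank 9 · closed · proved by Summit.AnomalousDissipation.AnomalousDissipation.Theorems.ThinSetLiouville.steadyNegTameOffThinSets_proof @ 81f4f735a1b8 (prover) · by planner
[support] SteadyNeg (stmt-AnomalousDissipation-0222) ON THE TAME-OFF-A-THIN-SET CLASS (idea card
bernoulli-poincare-thin-set-liouville, need N2 'SteadyNegTameOffThinSets'; plancard planner
2026-08-15; companion of support item stmt-AnomalousDissipation-1047 = SteadyThinSetLiouville). Same
quantifier prefix as SteadyNeg verbatim (fixed smooth div-free mean-zero f; ν_j>0, ν_j→0; steady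
classical NS solutions (u_j,p_j) on all of T³, written as time-constant IsClassicalNSSolutionOn
univ; ∫‖u_j‖² ≤ E), PLUS: a closed S ⊆ T³ with volume(S_ρ) ≤ Cρ² (codimension ≥ 2), a pair (U,P) C¹
off S solving (U·∇)U + ∇P = f, div U = 0 on Sᶜ, and u_j → U pointwise on Sᶜ. CONCLUSION ν_j‖∇u_j‖² →
0 (= SteadyNeg's conclusion). So SteadyNeg ⇒ this item trivially (checked in the planner sketch, rc
0), and this item is the first genuinely 3-D case of SteadyNeg beyond the energy identity (route Neg
NOVELTY: 'SteadyNeg has no 3-D literature beyond the steady energy identity'). PROOF (glue over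
stmt-1047, est. 150–250 lines given it): (i) steady energy identity ν_j·gradNormSq(u_j) = ∫⟪f,u_j⟫,
from the PROVED fact
Literature.Analysis.FunctionSpaces.Torus.IsClassicalNSSolutionOn.energy_balance_holds applied to t -/
@[route_item "route-AnomalousDissipation-CoherentStates"]
def SteadyNegTameOffThinSets : Prop :=
  ∀ f : UnitAddTorus (Fin 3) → EuclideanSpace ℝ (Fin 3), Literature.Analysis.FunctionSpaces.Torus.IsSmooth f → Literature.Analysis.FunctionSpaces.Torus.IsDivFree f → Literature.Analysis.FunctionSpaces.Torus.HasZeroMean f → ∀ (ν : ℕ → ℝ) (u : ℕ → UnitAddTorus (Fin 3) → EuclideanSpace ℝ (Fin 3)) (p : ℕ → UnitAddTorus (Fin 3) → ℝ), (∀ j, 0 < ν j) → Filter.Tendsto ν Filter.atTop (nhds 0) → (∀ j, Literature.Analysis.FunctionSpaces.Torus.IsClassicalNSSolutionOn Set.univ (ν j) (fun _ => f) (fun _ => u j) (fun _ => p j)) → (∃ E : ℝ, ∀ j, MeasureTheory.integral MeasureTheory.volume (fun x => ‖u j x‖ ^ 2) ≤ E) → ∀ (U : UnitAddTorus (Fin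 3) → EuclideanSpace ℝ (Fin 3)) (P : UnitAddTorus (Fin 3) → ℝ) (S : Set (UnitAddTorus (Fin 3))), IsClosed S → (∃ C : ℝ, ∀ ρ : ℝ, 0 < ρ → MeasureTheory.volume (Metric.thickening ρ S) ≤ ENNReal.ofReal (C * ρ ^ 2)) → ContDiffOn ℝ 1 (Literature.Analysis.FunctionSpaces.Torus.lift U) (Literature.Analysis.FunctionSpaces.Torus.proj ⁻¹' Sᶜ) → ContDiffOn ℝ 1 (Literature.Analysis.FunctionSpaces.Torus.lift P) (Literature.Analysis.FunctionSpaces.Torus.proj ⁻¹' Sᶜ) → (∀ x ∈ Sᶜ, Literature.Analysis.FunctionSpaces.Torus.convect U U x + Literature.Analysis.FunctionSpaces.Torus.gradient P x = f x) → (∀ x ∈ Sᶜ, Literature.Analysis.FunctionSpaces.Torus.divergence U x = 0) → (∀ x ∈ Sᶜ, Filter.Tendsto (fun j => u j x) Filter.atTop (nhds (U x))) → Filter.Tendsto (fun j => ν j * Literature.Analysis.FunctionSpaces.Torus.gradNormSq (u j)) Filter.atTop (nhds 0)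

/-- item stmt-AnomalousDissipation-10872 · support · rank 9 · closed · proved by Summit.AnomalousDissipation.AnomalousDissipation.Theorems.steadyImpliesCoherent_proof (prover) · by planner
[support] Second-layer glue (D-0019 two-layer plan): the rank-2 crux SteadyZerothLaw (stmt-0219:
fixed smooth div-free mean-zero f; ν_j → 0; STEADY classical solutions (u_j,p_j) on all of T³
written as time-constant IsClassicalNSSolutionOn univ; ∫‖u_j‖² ≤ E; ε ≤ ν_j·gradNormSq u_j) implies
the target CoherentThesis (stmt-0218), so that together with the deciding theorem `closes (hX :
CoherentThesis) (hLH : ClassicalGlobalIsGlobalLerayHopf) : AnomalousDissipation` a proof of the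
steady crux closes the route. PROOF SKETCH (≤ 80 lines, provable now, no fact needed): take τ_j := 1
(a time-constant field is 1-periodic: Function.Periodic (fun _ => u j) 1 by rfl); meanEnergy (fun _
=> u j) = longTimeAvgSup (fun _ => ∫‖u_j‖²) = ∫‖u_j‖² and meanDissipation (ν j) (fun _ => u j) =
longTimeAvgSup (fun _ => ν_j·(eGradNormSq u_j).toReal) = ν_j·(eGradNormSq u_j).toReal — Cesàro mean
of a constant: timeMean c T = c for T ≠ 0 (or the proved
Literature.Turb.tendsto_timeMean_of_periodic, Theorems/EulerLimitCesaro.lean, item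
CesaroMeanPeriodic); finally (eGradNormSq u_j).toReal = gradNormSq u_j by the PROVED
Literature.Analysis.FunctionSpaces.Torus.gradNormSq_eq_toReal_eGradNormSq_holds (TorusFourierC -/
@[route_item "route-AnomalousDissipation-CoherentStates"]
def SteadyImpliesCoherent : Prop :=
  SteadyZerothLaw → CoherentThesis

/-- item stmt-AnomalousDissipation-0266 · assembly · rank 1 · closed · proved by Summit.AnomalousDissipation.AnomalousDissipation.Theorems.coherentStatesAssembly_proof (prover) · by planner
via bridge lemma #6 (classical global ⇒ IsGlobalLerayHopf from u j 0; steady smooth f is space-time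
smooth as in Literature.Analysis.FluidPDE.BrueDeLellisQuestion22.question21). -/
@[route_item "route-AnomalousDissipation-CoherentStates"]
def Assembly : Prop :=
  CoherentThesis → ClassicalGlobalIsGlobalLerayHopf → AnomalousDissipation

-- records of items no longer active in this route (dropped / restated):
-- earlier Assembly2 (stmt-AnomalousDissipation-0406, dropped 2026-08-16T14:43:05Z): proved by Summit.AnomalousDissipation.AnomalousDissipation.Theorems.coherentStates_assembly2_proof — (∀ (ν : ℝ) (f u : ℝ → UnitAddTorus (Fin 3) → EuclideanSpace ℝ (Fin 3)) (p : ℝ → UnitAddTorus (Fin 3) → ℝ), 0 < ν → Literature.Analysis.FunctionSpaces.Torus.IsClassicalNSSolutionOn Set.univ ν f u p → Literature.Analysi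
-- earlier Assembly3 (stmt-AnomalousDissipation-0437, dropped 2026-08-16T14:43:05Z): proved by Summit.AnomalousDissipation.AnomalousDissipation.Theorems.Assembly3_proof — ClassicalGlobalIsGlobalLerayHopf → CoherentThesis → AnomalousDissipation

/-! D-0027 §2.1 — DECIDING THEOREM (planner-authored via `route open/edit --closes-file`; by planner-rbadge-AnomalousDissipation-CoherentSt-498b693b-g4-0 2026-08-16T05:45:55Z):
its hypotheses are this route's items and its conclusion the sub-problem Statement (glue_lint), and it elaborates with this file. -/

/-- **The route glue (D-0027 `closes`), crux-only form (rev 6, 2026-08-16).** Thesis X alone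
(`CoherentThesis`, item 0218, crux rank 0) decides the sub-problem
`AnomalousDissipation = Literature.Turb.ZerothLaw`: each `u j` is a classical solution of
NS_{ν j} on all of `ℝ × T³`, hence a global Leray–Hopf solution from the datum `u j 0` by the
PROVED Literature theorem `Literature.Analysis.FunctionSpaces.Torus.IsClassicalNSSolutionOn.isGlobalLerayHopf`
(module `Literature.Analysis.FluidPDE.TorusClassicalLerayHopfProofs`, discharging the named fact
`Torus.isGlobalLerayHopf_of_isClassicalNSSolutionOn`; Robinson–Rodrigo–Sadowski 2016 Thm 6.5 /
Def 4.9, Galdi 2000 Thm 4.1); the force, viscosity, mean-energy and mean-dissipation clauses of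
the Statement are those of X verbatim (same functionals `meanEnergy`, `meanDissipation`). The
former second hypothesis `ClassicalGlobalIsGlobalLerayHopf` (support item 0223) is no longer a
hypothesis: it is that fact's body and is itself one line from
`Literature.Analysis.FluidPDE.Torus.isGlobalLerayHopf_of_isClassicalNSSolutionOn_holds`.
Pure logic; axioms ⊆ {propext, Classical.choice, Quot.sound}. The ranked cruxes
(`SteadyZerothLaw`, `CheskidovSteadyForces`, `SteadyNeg`) are the ways into / against X and are
deliberately not hypotheses here (`SteadyImpliesCoherent : SteadyZerothLaw → CoherentThesis`). -/
@[closes "route-AnomalousDissipation-CoherentStates"] theorem closes (hX : CoherentThesis) : _root_.AnomalousDissipation := by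
  obtain ⟨f, hf, hdiv, hmean, ν, τ, u, p, hν, hν0, hsol, hE, hε⟩ := hX
  exact ⟨f, hf, hdiv, hmean, ν, fun j => u j 0, u, hν, hν0,
    fun j => Literature.Analysis.FunctionSpaces.Torus.IsClassicalNSSolutionOn.isGlobalLerayHopf (hsol j).1,
    hE, hε⟩

end Summit.AnomalousDissipation.AnomalousDissipation.Theses.CoherentStates
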